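import Literature.NumberTheory.Automorphic.Liu2021.SplitPlaceHeckeEigenvaluesQuadExtPackage
import Literature.NumberTheory.Automorphic.Liu2021.SplitPlaceOscillatorModelExplicit
import HarnessLib

/-!
# [Liu2021, App. D, proof of Lemma D.1, first paragraph] at a split place for THE `χ`-PACKAGE ([GelbartRogawski1991, Prop. 3.1.1] ∕
# [Kudla1994, Thm 3.1]) at EVERY rank `N ≥ 2`: the oscillator quotient is `Ind_{Q_{N-1,1}}^{GL_N(E_w)}((χ_w ∘ det) ⊠ χ′ χ_w^{1-N})`
# with the first Levi character `ν = χ_w` EXPLICIT — the `TODO(general form)` of `SplitPlaceOscillatorModel` discharged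

Topic `Literature/NumberTheory/Automorphic/Liu2021`; proof file (theorems only: no definition, no named fact, no instance, no `sorry`);
count-neutral.

The tree proves the split-place model of the local theta quotient in three currencies:
* ★ `splitPlace_chiCoinv_iso_parabolicIndGL_holds` ∕ `…_uniform` (`SplitPlaceOscillatorModelUniform`): for ANY smooth unitary section `s`,
  `∃ ν ∃ χ′` with `(χ-coinvariants of ω_s) ∘ localPiSplitEquiv⁻¹ ≃ Ind((ν ∘ det) ⊠ χ′ν^{1-N})` — `ν` EXISTENTIAL (the file's own
  `-- TODO(general form): ν read off the splitting character μ_v = ν ⊠ ν⁻¹ of [HKS96, §1]`);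
* ★ `splitPlace_chiCoinv_iso_parabolicIndGL_explicit` (`SplitPlaceOscillatorModelExplicit`): the same with a mixed-model pair `(Γ, η)`,
  `νK`, `ν`, `χ′` as INPUTS pinned in graph form — no existential, but the inputs are the consumer's to supply;
* ★ `exists_mixedModel_undoubleLoc_localSplittingDatumQuadExt'` (`LocalSplittingQuadExtSplitMixedModel` §2): for THE `χ`-package of a
  unitary global splitting character `χ` of `E/F` (the undoubling of Kudla's doubled splitting, `localSplittingDatumQuadExt`; for a CM field
  `localSplittingDatumCM`, `rfl`) the mixed model at ANY `w ∣ v` has character `η = χ_w ∘ det ∘ pr_w` — i.e. `νK = χ_w ∘ ι_w`, **`ν = χ_w`**.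
They are composed in the tree only at `N = 2` and only into the Hecke eigen-equations (★ `SplitPlaceHeckeEigenvaluesQuadExtPackage`
:177 ∕ :268).  THIS FILE composes them at every `N ≥ 2` into the MODEL statement:

* `splitPlace_chiCoinv_iso_parabolicIndGL_undoubleLoc_localSplittingDatumQuadExt` — quadratic `E/F`, `T = diag t ∈ GL_N(F)`, `J = T ⊗ 1`,
  `v` split, ANY `w ∣ v` with `c • w ≠ w`, `χ` a unitary splitting character, `s = undoubleLoc (localSplittingDatumQuadExt … χ hχ).localSplitting`,
  a hermitian line `J₁`, a unitary continuous `χc` of the centre with `w`-reading `χ′` (`χ′(z_w) = χc z`): `χ′` is unitary continuous and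
  **`(χc-coinvariants of ω_s) ∘ localPiSplitEquiv⁻¹ ≃ parabolicIndGL E_w (lastBlockLabel N) (𝟙.twist (maxParabolicLeviChar N χ_w (χ′ χ_w^{1-N})))`**;
* `splitPlace_chiCoinv_iso_parabolicIndGL_localSplittingCM` — the CM package of the tree: `L` CM, `s := localSplittingCM L N hT₀ hT₀d hJ θ hθ v`,
  **`ν = θ_w`**, NO measure, NO model data, NO chosen place in the statement.

USE (cell hodgecm-mathlib, crux H413, programme P2, PKΠ RUNG 4 row DICT_split; prover census `F0/P2/CENSUS-LTY-DICTsplit.F0P2p01g5.md` (m3)):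
Liu's local theta type `X_v(μ, ε, χ)` of [Liu2021, Def. 4.11] at a place `v` of `L⁺` split in `L` is carried by the section
`(chiLocalSplittingsD … (toHeckeCharacter μ) … ε).s v = localSplittingCM L n … (toHeckeCharacter μ) … v` (★ `congrW_undoubledSplittings_cmFinLocalFamily_s`),
so by the second theorem it is `Ind_{Q_{2,1}}^{GL₃(L_w)}((μ_w ∘ det₂) ⊠ χ′_w μ_w⁻²)` — the same normalised induction as the split member
`i_G(ξ_w ⊗ μ_w ∘ det₀)` of Rogawski's packet (★ `Rogawski1990.splitMemberGL`, [Rogawski1990, Lemma 4.13.1 (b)]); the dictionary row DICT_split is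
thereby reduced to two identities of characters of `L_wˣ`.  HC_CM is NOT proved by anything here.

## References
* [Liu2021] Y. Liu, *Fourier–Jacobi cycles and arithmetic relative trace formula*, Camb. J. Math. 9 (2021) = arXiv:2102.11518: App. D §D.1,
  proof of Lemma D.1, first paragraph (p. 126, l. 5241): «`ω(μ, ε, χ)` is isomorphic to the unitary induction from `Q_{n-1,1}` of `(ν∘det) ⊠ χν^{1-n}`,
  `μ = ν ⊠ ν⁻¹`».
* [MoeglinVignerasWaldspurger1987] C. Mœglin, M.-F. Vignéras, J.-L. Waldspurger, LNM 1291 (1987), Chap. 3 §III.1, §III.7 a).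
* [Kudla1994] S. Kudla, Israel J. Math. 87 (1994), §3 Thm 3.1.  [HarrisKudlaSweet1996] M. Harris, S. Kudla, W. J. Sweet, J. AMS 9 (1996), §1 (1.15)–(1.16).
* [GelbartRogawski1991] S. Gelbart, J. Rogawski, Invent. Math. 105 (1991), §3.1 Prop. 3.1.1 p. 455.
* [Rogawski1990] J. Rogawski, Ann. of Math. Stud. 123 (1990), Lemma 4.13.1 (b), §13.3 p. 201.
-/

set_option autoImplicit false

noncomputable section

open NumberField IsDedekindDomain Matrix
open _root_.MeasureTheory
open scoped MatrixGroups
open ValuativeRel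
open Literature.RepresentationTheory (TwistedCoinv.rep TwistedCoinv.Coinv TwistedCoinv.mk)
open Literature.RepresentationTheory.HeisenbergGroup (MpPsi leviOpPi ImplementerSection)
open Literature.RepresentationTheory.HeisenbergGroup.SymplecticMatrix (glEquiv)
open Literature.NumberTheory.Automorphic.Zelevinsky1980 (lastBlockLabel maxParabolicLeviChar)
open Literature.NumberTheory.Automorphic.UnitaryGroup
open Literature.NumberTheory.Automorphic Literature.NumberTheory.Weil1964
open Literature.RepresentationTheory.HarrisKudlaSweet1996 Literature.NumberTheory.GaloisRepresentations

namespace Literature.NumberTheory.Automorphic.Liu2021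

open Literature.NumberTheory.GelbartRogawski1991.UnitaryDualPair.LocalSplitting (iota LocalMp localSchrodinger undoubleLoc
  gramD proj_undoubleLoc isSmooth_toRep_comp_undoubleLoc isL2Isometric_toRep_comp_undoubleLoc hermD_conj_transpose
  isUnit_placeFormD localSplittingCMWith localSplittingCM)
open Literature.NumberTheory.GelbartRogawski1991.UnitaryDualPair.LocalSplitting.QuadExt
open Literature.NumberTheory.GelbartRogawski1991.UnitaryDualPair (imagUnit complexConj_imagUnit imagUnit_ne_zero imagUnit_mul_self)

/-! ## §1 The undoubled `χ`-package of a quadratic extension `E/F` at a split place: `ν = χ_w`, every `N ≥ 2` -/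

set_option maxHeartbeats 2000000 in -- as in `SplitPlaceHeckeEigenvaluesQuadExtPackage`: ≈ 40 heavy binders over `SchwartzBruhat` ∕ `U(J)(F_v)`
/-- **[Liu2021, App. D, proof of Lem. D.1, first paragraph] for THE UNDOUBLED `χ`-PACKAGE at a split place, every `N ≥ 2`, `ν = χ_w` at
EITHER `w ∣ v`.**  Data: a quadratic extension `E/F` of number fields (`c ≠ 1`, `δ`), `T = diag t ∈ GL_N(F)` (`N ≥ 2`), `J = T ⊗ 1`, a place `v`
of `F` split in `E` and ANY `w ∣ v` with `c • w ≠ w` (`J` invertible at `w`), Haar data `μ` on `F_v`, a UNITARY global splitting character `χ`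
of `E/F` (`χ|_{𝕀_F} = ε_{E/F}`), `s` THE undoubling of the package's local splitting (`hs`, `rfl` for the tree's terms), a hermitian line `J₁`,
a unitary continuous character `χc` of the centre `U(J₁)(F_v)` and its `w`-reading `χ′` (`χ′(z_w) = χc z`).  Conclusion: `χ_w` and `χ′` are
unitary continuous, and the representation of `GL_N(E_w)` (along ★ `localPiSplitEquiv`) on the `χc`-coinvariants of `ω_s` under the centre is
`AreIsomorphicRep` to `parabolicIndGL E_w (lastBlockLabel N) (𝟙.twist (maxParabolicLeviChar N χ_w (χ′ · χ_w^{1-N})))`.  Proof: ★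
`splitPlace_chiCoinv_iso_parabolicIndGL_explicit` with `hs := proj_undoubleLoc`, `hsm` ∕ `hsu` (★ `isSmooth_toRep_comp_undoubleLoc`, ★
`isL2Isometric_toRep_comp_undoubleLoc` over ★ `norm_beta_localSplittingDatumQuadExt_eq_one`), the mixed model `(Γ, η)` of ★
`exists_mixedModel_undoubleLoc_localSplittingDatumQuadExt'`, `νK := χ_w ∘ ι_w`, `hη :=` ★ `chi_det_symm_map`, `ν := χ_w`, `hν := rfl`.
[cite: Liu2021, App. D, proof of Lemma D.1 (first paragraph), p. 126] [cite: MoeglinVignerasWaldspurger1987, Chap. 3 III.1, III.7 a)]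
[cite: Kudla1994, §3 Thm. 3.1] [cite: HarrisKudlaSweet1996, §1 (1.15)–(1.16)] -/
theorem splitPlace_chiCoinv_iso_parabolicIndGL_undoubleLoc_localSplittingDatumQuadExt
    (F : Type) [Field F] [NumberField F] (E : Type) [Field E] [NumberField E] [Algebra F E]
    [Algebra.IsQuadraticExtension F E] (c : E ≃ₐ[F] E) (hc1 : c ≠ 1) (N : ℕ) (hN : 2 ≤ N) (δ : E) (hcδ : c δ = -δ)
    (hδ : δ ≠ 0) (d : F) (hd : δ * δ = algebraMap F E d) (T : Matrix (Fin N) (Fin N) F) (hT : T.IsSymm) (hTd : IsUnit T.det)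
    (t : Fin N → F) (hTt : T = Matrix.diagonal t)
    (J : Matrix (Fin N) (Fin N) E) (hJ : J = T.map (algebraMap F E)) (hJh : (J.map c)ᵀ = J)
    {JD : Matrix (Fin (N + N)) (Fin (N + N)) E} (hJD : JD = (gramD F N T).map (algebraMap F E))
    (v : HeightOneSpectrum (𝓞 F)) (w : UnitaryGroup.PlacesOver E v) (hw : c • (w : HeightOneSpectrum (𝓞 E)) ≠ w)
    (hJw : IsUnit (UnitaryGroup.placeForm J (w : HeightOneSpectrum (𝓞 E))))
    [MeasurableSpace (v.adicCompletion F)] [BorelSpace (v.adicCompletion F)]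
    (μ : Measure (v.adicCompletion F)) [μ.IsAddHaarMeasure]
    (χ : HeckeCharacter E) (hχ : IsSplittingCharExt F E 1 χ) (hχu : χ.IsUnitary)
    (s : UnitaryGroup.localPi E c N J v →* LocalMp F N T v)
    (hs : s = undoubleLoc F E c v N hJ hJD hcδ hδ hd hT hTd
      (localSplittingDatumQuadExt F E c hcδ hδ hd v μ N hT hTd hJD χ hχ).localSplitting
      (localSplittingDatumQuadExt F E c hcδ hδ hd v μ N hT hTd hJD χ hχ).proj_localSplitting)
    (J₁ : Matrix (Fin 1) (Fin 1) E) (hJ₁ : J₁ 0 0 ≠ 0)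
    [LocallyCompactSpace (standardParabolicGL ((w : HeightOneSpectrum (𝓞 E)).adicCompletion E)
      (Zelevinsky1980.lastBlockLabel N))]
    (χc : UnitaryGroup.localPi E c 1 J₁ v →* ℂˣ) (hχcu : ∀ z, ‖((χc z : ℂˣ) : ℂ)‖ = 1)
    (hχcc : Continuous fun z => ((χc z : ℂˣ) : ℂ))
    (χ' : ((w : HeightOneSpectrum (𝓞 E)).adicCompletion E)ˣ →* ℂˣ)
    (hχ' : ∀ z : UnitaryGroup.localPi E c 1 J₁ v,
      χ' (Matrix.GeneralLinearGroup.det ((z : UnitaryGroup.LocalGLPi E 1 v) w)) = χc z) :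
    ((∀ x, ‖(((χ.localComponent (w : HeightOneSpectrum (𝓞 E))) x : ℂˣ) : ℂ)‖ = 1) ∧
        (Continuous fun x => (((χ.localComponent (w : HeightOneSpectrum (𝓞 E))) x : ℂˣ) : ℂ)) ∧
      (∀ x, ‖((χ' x : ℂˣ) : ℂ)‖ = 1) ∧ (Continuous fun x => ((χ' x : ℂˣ) : ℂ))) ∧
    AreIsomorphicRep
      ((TwistedCoinv.rep
        (ρW := show Representation ℂ (UnitaryGroup.localPi E c 1 J₁ v) (SchwartzBruhat (Fin N → v.adicCompletion F)) from
          ((MpPsi.toRep (localSchrodinger F N T v)).comp s).comp (UnitaryGroup.localCenter E c N J J₁ hJ₁ v))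
        χc ((MpPsi.toRep (localSchrodinger F N T v)).comp s)
        (fun g z => (show Commute g (UnitaryGroup.localCenter E c N J J₁ hJ₁ v z) from
          UnitaryGroup.localCenter_comm E c N J J₁ hJ₁ v z g).map ((MpPsi.toRep (localSchrodinger F N T v)).comp s))).comp
        (UnitaryGroup.localPiSplitEquiv c J hc1 hJh w hw hJw).symm.toMonoidHom)
      (Representation.parabolicIndGL ((w : HeightOneSpectrum (𝓞 E)).adicCompletion E) (Zelevinsky1980.lastBlockLabel N)
        ((Representation.trivial ℂ (Π a : Bool, GL {i : Fin N // Zelevinsky1980.lastBlockLabel N i = a}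
            ((w : HeightOneSpectrum (𝓞 E)).adicCompletion E)) ℂ).twist
          (Zelevinsky1980.maxParabolicLeviChar ((w : HeightOneSpectrum (𝓞 E)).adicCompletion E) N
            (χ.localComponent (w : HeightOneSpectrum (𝓞 E)))
            (χ' * (χ.localComponent (w : HeightOneSpectrum (𝓞 E))) ^ (1 - (N : ℤ)))))) := by
  subst hs
  have hNpos : 0 < N := by omega
  haveI := secondCountableTopology_adicCompletion F v
  haveI : (Measure.pi fun _ : Fin N => μ).IsAddHaarMeasure := Measure.pi.isAddHaarMeasure _
  obtain ⟨Γ, hΓi, hmodel⟩ := exists_mixedModel_undoubleLoc_localSplittingDatumQuadExt' F E c hcδ hδ hd v μ N hT hTd hJ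
    hJD χ hχ hNpos t hTt w hw hc1 hJh (hermD_conj_transpose F E c N hT hJD) hJw (isUnit_placeFormD F E v N hTd hJD w) μ
  exact splitPlace_chiCoinv_iso_parabolicIndGL_explicit F E c hc1 N hN δ hcδ hδ d hd T hT hTd J hJ hJh v w hw hJw
    (Measure.pi fun _ : Fin N => μ) _
    (proj_undoubleLoc F E c v N hJ hJD hcδ hδ hd hT hTd _ _)
    (isSmooth_toRep_comp_undoubleLoc F E c hcδ hδ hd v μ N hT hTd hJ hJD _)
    (isL2Isometric_toRep_comp_undoubleLoc F E c hcδ hδ hd v μ N hT hTd hJ hJD _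
      (norm_beta_localSplittingDatumQuadExt_eq_one F E c hcδ hδ hd v μ N hT hTd hJD χ hχ hχu) μ)
    J₁ hJ₁ μ Γ _ hΓi hmodel
    ((χ.localComponent (w : HeightOneSpectrum (𝓞 E))).comp
      (Units.map (toPlace v w : v.adicCompletion F →+* (w : HeightOneSpectrum (𝓞 E)).adicCompletion E).toMonoidHom))
    (chi_det_symm_map F E c v N hc1 hJh w hw hJw (χ.localComponent (w : HeightOneSpectrum (𝓞 E))))
    (χ.localComponent (w : HeightOneSpectrum (𝓞 E))) (fun _ => rfl) χc hχcu hχcc χ' hχ'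

/-! ## §2 The CM package of the tree: `s = localSplittingCM L N … θ hθ v`, `ν = θ_w` -/

set_option maxHeartbeats 2000000 in -- as above
/-- **[Liu2021, App. D, proof of Lem. D.1, first paragraph] for THE CM PACKAGE `localSplittingCM` of the tree, every `N ≥ 2`, `ν = θ_w` at
EITHER `w ∣ v`.**  For a CM field `L/L⁺` (`c` = complex conjugation), `T₀ = diag t ∈ GL_N(L⁺)`, `J = T₀ ⊗ 1`, a unitary splitting character
`θ` of `L` (`IsSplittingChar L 1 θ`), a place `v` of `L⁺` split in `L`, ANY `w ∣ v` with `c • w ≠ w` (`J` invertible at `w`), a hermitian line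
`J₁`, a unitary continuous character `χc` of the centre `U(J₁)(L⁺_v)` with `w`-reading `χ′`: the representation of `GL_N(L_w)` on the
`χc`-coinvariants of `ω_s`, `s := localSplittingCM L N hT₀ hT₀d hJ θ hθ v`, is `AreIsomorphicRep` to
`parabolicIndGL L_w (lastBlockLabel N) (𝟙.twist (maxParabolicLeviChar N θ_w (χ′ · θ_w^{1-N})))` — NO measure, NO model data, NO chosen place, NO
existential.  Proof: §1 at `(L⁺, L, c, imagUnit L)` with the Borel σ-algebra and `Measure.addHaar` (`localSplittingCM` unfolds to
`undoubleLoc (localSplittingDatumCM …).localSplitting`, `localSplittingDatumCM = localSplittingDatumQuadExt …` by `rfl`).  This is the local theta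
type `X_v(μ, ε, χ)` of [Liu2021, Def. 4.11] at a split place when `θ = μ` (the `μ`-splitting of the Hodge CM programme): `ν = μ_w`.
[cite: Liu2021, App. D, proof of Lemma D.1 (first paragraph), p. 126] [cite: GelbartRogawski1991, §3.1 Prop. 3.1.1 p. 455]
[cite: Kudla1994, §3 Thm. 3.1] [cite: Rogawski1990, Lemma 4.13.1 (b)] -/
theorem splitPlace_chiCoinv_iso_parabolicIndGL_localSplittingCM
    (L : Type) [Field L] [NumberField L] [IsCMField L] (hc1 : IsCMField.complexConj L ≠ 1) (N : ℕ) (hN : 2 ≤ N)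
    (T₀ : Matrix (Fin N) (Fin N) (maximalRealSubfield L)) (hT₀ : T₀.IsSymm) (hT₀d : IsUnit T₀.det)
    (t : Fin N → maximalRealSubfield L) (hT₀t : T₀ = Matrix.diagonal t)
    (J : Matrix (Fin N) (Fin N) L) (hJ : J = T₀.map (algebraMap (maximalRealSubfield L) L))
    (hJh : (J.map (IsCMField.complexConj L))ᵀ = J)
    (v : HeightOneSpectrum (𝓞 (maximalRealSubfield L))) (w : UnitaryGroup.PlacesOver L v)
    (hw : IsCMField.complexConj L • (w : HeightOneSpectrum (𝓞 L)) ≠ w)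
    (hJw : IsUnit (UnitaryGroup.placeForm J (w : HeightOneSpectrum (𝓞 L))))
    (θ : HeckeCharacter L) (hθ : IsSplittingChar L 1 θ) (hθu : θ.IsUnitary)
    (J₁ : Matrix (Fin 1) (Fin 1) L) (hJ₁ : J₁ 0 0 ≠ 0)
    [LocallyCompactSpace (standardParabolicGL ((w : HeightOneSpectrum (𝓞 L)).adicCompletion L)
      (Zelevinsky1980.lastBlockLabel N))]
    (χc : UnitaryGroup.localPi L (IsCMField.complexConj L) 1 J₁ v →* ℂˣ) (hχcu : ∀ z, ‖((χc z : ℂˣ) : ℂ)‖ = 1)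
    (hχcc : Continuous fun z => ((χc z : ℂˣ) : ℂ))
    (χ' : ((w : HeightOneSpectrum (𝓞 L)).adicCompletion L)ˣ →* ℂˣ)
    (hχ' : ∀ z : UnitaryGroup.localPi L (IsCMField.complexConj L) 1 J₁ v,
      χ' (Matrix.GeneralLinearGroup.det ((z : UnitaryGroup.LocalGLPi L 1 v) w)) = χc z) :
    ((∀ x, ‖(((θ.localComponent (w : HeightOneSpectrum (𝓞 L))) x : ℂˣ) : ℂ)‖ = 1) ∧
        (Continuous fun x => (((θ.localComponent (w : HeightOneSpectrum (𝓞 L))) x : ℂˣ) : ℂ)) ∧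
      (∀ x, ‖((χ' x : ℂˣ) : ℂ)‖ = 1) ∧ (Continuous fun x => ((χ' x : ℂˣ) : ℂ))) ∧
    AreIsomorphicRep
      ((TwistedCoinv.rep
        (ρW := show Representation ℂ (UnitaryGroup.localPi L (IsCMField.complexConj L) 1 J₁ v)
            (SchwartzBruhat (Fin N → v.adicCompletion (maximalRealSubfield L))) from
          ((MpPsi.toRep (localSchrodinger (maximalRealSubfield L) N T₀ v)).comp
            (localSplittingCM L N hT₀ hT₀d hJ θ hθ v)).comp
            (UnitaryGroup.localCenter L (IsCMField.complexConj L) N J J₁ hJ₁ v))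
        χc ((MpPsi.toRep (localSchrodinger (maximalRealSubfield L) N T₀ v)).comp (localSplittingCM L N hT₀ hT₀d hJ θ hθ v))
        (fun g z => (show Commute g (UnitaryGroup.localCenter L (IsCMField.complexConj L) N J J₁ hJ₁ v z) from
          UnitaryGroup.localCenter_comm L (IsCMField.complexConj L) N J J₁ hJ₁ v z g).map
          ((MpPsi.toRep (localSchrodinger (maximalRealSubfield L) N T₀ v)).comp
            (localSplittingCM L N hT₀ hT₀d hJ θ hθ v)))).comp
        (UnitaryGroup.localPiSplitEquiv (IsCMField.complexConj L) J hc1 hJh w hw hJw).symm.toMonoidHom)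
      (Representation.parabolicIndGL ((w : HeightOneSpectrum (𝓞 L)).adicCompletion L) (Zelevinsky1980.lastBlockLabel N)
        ((Representation.trivial ℂ (Π a : Bool, GL {i : Fin N // Zelevinsky1980.lastBlockLabel N i = a}
            ((w : HeightOneSpectrum (𝓞 L)).adicCompletion L)) ℂ).twist
          (Zelevinsky1980.maxParabolicLeviChar ((w : HeightOneSpectrum (𝓞 L)).adicCompletion L) N
            (θ.localComponent (w : HeightOneSpectrum (𝓞 L)))
            (χ' * (θ.localComponent (w : HeightOneSpectrum (𝓞 L))) ^ (1 - (N : ℤ)))))) := by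
  letI : MeasurableSpace (v.adicCompletion (maximalRealSubfield L)) := borel _
  haveI : BorelSpace (v.adicCompletion (maximalRealSubfield L)) := ⟨rfl⟩
  exact splitPlace_chiCoinv_iso_parabolicIndGL_undoubleLoc_localSplittingDatumQuadExt (maximalRealSubfield L) L
    (IsCMField.complexConj L) hc1 N hN (imagUnit L) (complexConj_imagUnit L) (imagUnit_ne_zero L) _ (imagUnit_mul_self L) T₀ hT₀
    hT₀d t hT₀t J hJ hJh rfl v w hw hJw Measure.addHaar θ ((isSplittingChar_iff_isSplittingCharExt L 1 θ).1 hθ) hθu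
    (localSplittingCM L N hT₀ hT₀d hJ θ hθ v) rfl J₁ hJ₁ χc hχcu hχcc χ' hχ'

end Literature.NumberTheory.Automorphic.Liu2021

end
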